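import Summits.CriticalPhenomena.PercolationContinuityZ3.Theorems.SahiAEPlaneQuadrant
import Summits.CriticalPhenomena.PercolationContinuityZ3.Theorems.SahiAEPlaneGlue

/-!
# The planar structure theorem: in dimension two every a.e.-supermodular measurable function has a Borel version supermodular at every pair — no boundedness needed

Support file of the Sahi cell (`prim-sahi`, typer seat, generation 22; `--supports stmt-CriticalPhenomena-4575`).
Theorems only (no definitions, no named facts, no sorries).

R5 (Borel everywhere-MTP₂ versions) was proved for densities bounded away from `0` and `∞`
(`exists_pos_measurable_mtp2_version_of_ae_pi`, every dimension, every product σ-finite reference measure); densities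
not bounded away from `0` and `∞` were listed as open.  In the PLANE the boundedness hypothesis can be dropped
altogether:

* `Plane.exists_measurable_supermodular_version_of_ae_plane` — a measurable `φ : ℝ² → ℝ` (`ℝ² = Fin 2 → ℝ`, Lebesgue
  measure) with `φ(x) + φ(y) ≤ φ(x ∧ y) + φ(x ∨ y)` for `λ² ⊗ λ²`-almost every `(x, y)` has a measurable version
  `ψ = φ` a.e. with `ψ(x) + ψ(y) ≤ ψ(x ∧ y) + ψ(x ∨ y)` for ALL `x, y`;
* `Plane.exists_measurable_mtp2_version_of_ae_plane` — multiplicative form: a measurable `f : ℝ² → (0, ∞)`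
  (finite and non-zero everywhere, otherwise arbitrary) which is MTP₂ on almost every pair has a measurable version
  with values in `(0, ∞)` which is MTP₂ at every pair.

Proof: around a generic base point `b = (s₀, t₀)` write `φ = D + φ(x₀, t₀) + φ(s₀, x₁) − φ(b)`; the separable part
is modular, and the double increment `D` is, on each of the four open quadrants, a.e. sign-definite, a.e. monotone
for the quadrant's orthant order and a.e. supermodular, with local essential bounds from generic larger points — so
the lower-corner envelope (`SahiAECornerEnvelopeLocal`) of `𝟙_Q e^{D}` (after reflecting the quadrant to the
principal one, `SahiAEPlaneQuadrant`) is a monotone everywhere-supermodular version on the open quadrant; setting the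
version to `0` on the cross through `b`, the increments over all rectangles are non-negative by subdivision at the
cross (`SahiAEPlaneGlue`), which in dimension two is supermodularity at every pair.  (In dimension `≥ 3` the double
increments are not monotone in any orthant order off the principal orthants, and the separable tilt of
`SahiAESeparableTilt` needs bounds; the unbounded case remains open there.)  No sorries, no new axioms.
-/

noncomputable section

namespace Summit.CriticalPhenomena.PercolationContinuityZ3.Theorems.SahiAEFourFunctions.Plane

open MeasureTheory Set Filter Topology Function
open scoped ENNReal NNReal

/-- A point of the plane is the vector of its two coordinates. [folklore] -/
private theorem eta₃ (x : Fin 2 → ℝ) : x = ![x 0, x 1] := by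
  ext i; fin_cases i <;> rfl

/-- First coordinate of an explicit point. [folklore] -/
@[simp] private theorem vz (s t : ℝ) : (![s, t] : Fin 2 → ℝ) 0 = s := rfl

/-- Second coordinate of an explicit point. [folklore] -/
@[simp] private theorem vo (s t : ℝ) : (![s, t] : Fin 2 → ℝ) 1 = t := rfl

/-- **The planar structure theorem (additive form).**  A measurable function on the plane which is supermodular on
Lebesgue-almost every pair has a measurable version which is supermodular at EVERY pair; no boundedness or
integrability is assumed. [this work] -/
theorem exists_measurable_supermodular_version_of_ae_plane (φ : (Fin 2 → ℝ) → ℝ) (hφ : Measurable φ)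
    (hsm : ∀ᵐ p : (Fin 2 → ℝ) × (Fin 2 → ℝ) ∂((volume : Measure (Fin 2 → ℝ)).prod volume),
      φ p.1 + φ p.2 ≤ φ (p.1 ⊓ p.2) + φ (p.1 ⊔ p.2)) :
    ∃ ψ : (Fin 2 → ℝ) → ℝ, Measurable ψ ∧ ψ =ᵐ[volume] φ ∧ ∀ x y, ψ x + ψ y ≤ ψ (x ⊓ y) + ψ (x ⊔ y) := by
  have hR := ae_rect_of_ae_supermodular hsm
  -- the three reflected functions and their quadrant packages
  set φ₁ : (Fin 2 → ℝ) → ℝ := fun x => -φ ![x 0, -x 1] with hφ₁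
  set φ₂ : (Fin 2 → ℝ) → ℝ := fun x => -φ ![-x 0, x 1] with hφ₂
  set φ₃ : (Fin 2 → ℝ) → ℝ := fun x => φ ![-x 0, -x 1] with hφ₃
  have hφ₁m : Measurable φ₁ := (hφ.comp measurePreserving_reflect₁.measurable).neg
  have hφ₂m : Measurable φ₂ := (hφ.comp measurePreserving_reflect₂.measurable).neg
  have hφ₃m : Measurable φ₃ := hφ.comp measurePreserving_reflect₃.measurable
  have P0 := quadrant_version φ hφ hR
  have P1 := measurePreserving_reflect₁.quasiMeasurePreserving.ae (quadrant_version φ₁ hφ₁m (ae_rect_reflect₁ hR))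
  have P2 := measurePreserving_reflect₂.quasiMeasurePreserving.ae (quadrant_version φ₂ hφ₂m (ae_rect_reflect₂ hR))
  have P3 := measurePreserving_reflect₃.quasiMeasurePreserving.ae (quadrant_version φ₃ hφ₃m (ae_rect_reflect₃ hR))
  obtain ⟨b, ⟨G₀, hG₀m, hG₀v, hG₀s, hG₀mo, hG₀n⟩, ⟨G₁, hG₁m, hG₁v, hG₁s, hG₁mo, hG₁n⟩,
    ⟨G₂, hG₂m, hG₂v, hG₂s, hG₂mo, hG₂n⟩, ⟨G₃, hG₃m, hG₃v, hG₃s, hG₃mo, hG₃n⟩⟩ :=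
    (P0.and (P1.and (P2.and P3))).exists
  simp only [vz, vo] at hG₁v hG₁s hG₁mo hG₁n hG₂v hG₂s hG₂mo hG₂n hG₃v hG₃s hG₃mo hG₃n
  -- the glued double increment and the version
  set Dt : (Fin 2 → ℝ) → ℝ := fun x =>
    ({u : Fin 2 → ℝ | b 0 < u 0 ∧ b 1 < u 1} : Set (Fin 2 → ℝ)).indicator G₀ x -
      ({u : Fin 2 → ℝ | (![b 0, -b 1] : Fin 2 → ℝ) 0 < u 0 ∧ (![b 0, -b 1] : Fin 2 → ℝ) 1 < u 1} :
          Set (Fin 2 → ℝ)).indicator G₁ ![x 0, -x 1] -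
      ({u : Fin 2 → ℝ | (![-b 0, b 1] : Fin 2 → ℝ) 0 < u 0 ∧ (![-b 0, b 1] : Fin 2 → ℝ) 1 < u 1} :
          Set (Fin 2 → ℝ)).indicator G₂ ![-x 0, x 1] +
      ({u : Fin 2 → ℝ | (![-b 0, -b 1] : Fin 2 → ℝ) 0 < u 0 ∧ (![-b 0, -b 1] : Fin 2 → ℝ) 1 < u 1} :
          Set (Fin 2 → ℝ)).indicator G₃ ![-x 0, -x 1] with hDt
  have hrect : ∀ s s' t t' : ℝ, s ≤ s' → t ≤ t' → Dt ![s, t'] + Dt ![s', t] ≤ Dt ![s, t] + Dt ![s', t'] :=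
    fun s s' t t' hss' htt' => rect_nonneg_glue b G₀ G₁ G₂ G₃ hG₀s hG₀mo hG₀n hG₁s hG₁mo hG₁n hG₂s hG₂mo hG₂n
      hG₃s hG₃mo hG₃n Dt (fun x => rfl) hss' htt'
  set ψ : (Fin 2 → ℝ) → ℝ := fun x => Dt x + φ ![x 0, b 1] + φ ![b 0, x 1] - φ b with hψ
  have mq : ∀ c : Fin 2 → ℝ, MeasurableSet ({u : Fin 2 → ℝ | c 0 < u 0 ∧ c 1 < u 1} : Set (Fin 2 → ℝ)) :=
    measurableSet_quadrant
  have hDtm : Measurable Dt := by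
    refine (((hG₀m.indicator (mq b)).sub ((hG₁m.indicator (mq _)).comp measurePreserving_reflect₁.measurable)).sub
      ((hG₂m.indicator (mq _)).comp measurePreserving_reflect₂.measurable)).add
      ((hG₃m.indicator (mq _)).comp measurePreserving_reflect₃.measurable)
  refine ⟨ψ, ((hDtm.add (hφ.comp (measurable_vec_fst (b 1)))).add (hφ.comp (measurable_vec_snd (b 0)))).sub
    measurable_const, ?_, ?_⟩
  · -- `ψ = φ` almost everywhere: off the cross, exactly one quadrant version is active
    have hb0 : ∀ᵐ x ∂(volume : Measure (Fin 2 → ℝ)), x 0 ≠ b 0 := by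
      rw [volume_pi]; exact Measure.ae_eval_ne (fun _ : Fin 2 => (volume : Measure ℝ)) 0 (b 0)
    have hb1 : ∀ᵐ x ∂(volume : Measure (Fin 2 → ℝ)), x 1 ≠ b 1 := by
      rw [volume_pi]; exact Measure.ae_eval_ne (fun _ : Fin 2 => (volume : Measure ℝ)) 1 (b 1)
    have hG₁v' := measurePreserving_reflect₁.quasiMeasurePreserving.ae hG₁v
    have hG₂v' := measurePreserving_reflect₂.quasiMeasurePreserving.ae hG₂v
    have hG₃v' := measurePreserving_reflect₃.quasiMeasurePreserving.ae hG₃v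
    filter_upwards [hb0, hb1, hG₀v, hG₁v', hG₂v', hG₃v'] with x hx0 hx1 h0 h1 h2 h3
    simp only [vz, vo, neg_lt_neg_iff, hφ₁, hφ₂, hφ₃, neg_neg] at h1 h2 h3
    rw [← eta₃ x, ← eta₃ b] at h1 h2 h3
    show Dt x + φ ![x 0, b 1] + φ ![b 0, x 1] - φ b = φ x
    simp only [hDt]
    rcases lt_or_gt_of_ne hx0 with hx0 | hx0 <;> rcases lt_or_gt_of_ne hx1 with hx1 | hx1
    · -- `x₀ < b₀`, `x₁ < b₁`: the doubly reflected quadrant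
      rw [Set.indicator_of_notMem (by simp only [Set.mem_setOf_eq, not_and]; intro h; linarith),
        Set.indicator_of_notMem (by simp only [Set.mem_setOf_eq, vz, vo, not_and]; intro h; linarith),
        Set.indicator_of_notMem (by simp only [Set.mem_setOf_eq, vz, vo, not_and]; intro h; linarith),
        Set.indicator_of_mem (by simp only [Set.mem_setOf_eq, vz, vo]; constructor <;> linarith)]
      linarith [h3 hx0 hx1]
    · -- `x₀ < b₀`, `b₁ < x₁`
      rw [Set.indicator_of_notMem (by simp only [Set.mem_setOf_eq, not_and]; intro h; linarith),
        Set.indicator_of_notMem (by simp only [Set.mem_setOf_eq, vz, vo, not_and]; intro h; linarith),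
        Set.indicator_of_mem (by simp only [Set.mem_setOf_eq, vz, vo]; constructor <;> linarith),
        Set.indicator_of_notMem (by simp only [Set.mem_setOf_eq, vz, vo, not_and]; intro h; linarith)]
      linarith [h2 hx0 hx1]
    · -- `b₀ < x₀`, `x₁ < b₁`
      rw [Set.indicator_of_notMem (by simp only [Set.mem_setOf_eq, not_and]; intro h; linarith),
        Set.indicator_of_mem (by simp only [Set.mem_setOf_eq, vz, vo]; constructor <;> linarith),
        Set.indicator_of_notMem (by simp only [Set.mem_setOf_eq, vz, vo, not_and]; intro h; linarith),
        Set.indicator_of_notMem (by simp only [Set.mem_setOf_eq, vz, vo, not_and]; intro h; linarith)]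
      linarith [h1 hx0 hx1]
    · -- `b₀ < x₀`, `b₁ < x₁`: the principal quadrant
      rw [Set.indicator_of_mem (show x ∈ {u : Fin 2 → ℝ | b 0 < u 0 ∧ b 1 < u 1} from ⟨hx0, hx1⟩),
        Set.indicator_of_notMem (by simp only [Set.mem_setOf_eq, vz, vo, not_and]; intro h; linarith),
        Set.indicator_of_notMem (by simp only [Set.mem_setOf_eq, vz, vo, not_and]; intro h; linarith),
        Set.indicator_of_notMem (by simp only [Set.mem_setOf_eq, vz, vo, not_and]; intro h; linarith)]
      linarith [h0 hx0 hx1]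
  · -- supermodular at every pair: rectangle increments of `Dt` are non-negative, the separable part is modular
    refine supermodular_of_rect fun s s' t t' hss' htt' => ?_
    simp only [hψ, vz, vo]
    linarith [hrect s s' t t' hss' htt']

/-- **The planar structure theorem (multiplicative form).**  A measurable `f : ℝ² → (0, ∞)` (`f ≠ 0`, `f ≠ ∞`
everywhere, no bounds) with `f(x) f(y) ≤ f(x ∧ y) f(x ∨ y)` for Lebesgue-almost every pair has a measurable version
`F` with `0 < F < ∞` and `F(x) F(y) ≤ F(x ∧ y) F(x ∨ y)` at EVERY pair. [this work] -/
theorem exists_measurable_mtp2_version_of_ae_plane (f : (Fin 2 → ℝ) → ℝ≥0∞) (hf : Measurable f)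
    (h0 : ∀ x, f x ≠ 0) (hT : ∀ x, f x ≠ ∞)
    (hMTP : ∀ᵐ p : (Fin 2 → ℝ) × (Fin 2 → ℝ) ∂((volume : Measure (Fin 2 → ℝ)).prod volume),
      f p.1 * f p.2 ≤ f (p.1 ⊓ p.2) * f (p.1 ⊔ p.2)) :
    ∃ F : (Fin 2 → ℝ) → ℝ≥0∞, Measurable F ∧ (∀ x, F x ≠ 0 ∧ F x ≠ ∞) ∧ F =ᵐ[volume] f ∧
      ∀ x y, F x * F y ≤ F (x ⊓ y) * F (x ⊔ y) := by
  have hpos : ∀ x, 0 < (f x).toReal := fun x => ENNReal.toReal_pos (h0 x) (hT x)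
  set φ : (Fin 2 → ℝ) → ℝ := fun x => Real.log (f x).toReal with hφ
  have hφm : Measurable φ := Real.measurable_log.comp (ENNReal.measurable_toReal.comp hf)
  have hsm : ∀ᵐ p : (Fin 2 → ℝ) × (Fin 2 → ℝ) ∂((volume : Measure (Fin 2 → ℝ)).prod volume),
      φ p.1 + φ p.2 ≤ φ (p.1 ⊓ p.2) + φ (p.1 ⊔ p.2) := by
    filter_upwards [hMTP] with p hp
    have hL : (f p.1 * f p.2).toReal ≤ (f (p.1 ⊓ p.2) * f (p.1 ⊔ p.2)).toReal :=
      ENNReal.toReal_mono (ENNReal.mul_ne_top (hT _) (hT _)) hp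
    rw [ENNReal.toReal_mul, ENNReal.toReal_mul] at hL
    simp only [hφ]
    rw [← Real.log_mul (hpos _).ne' (hpos _).ne', ← Real.log_mul (hpos _).ne' (hpos _).ne']
    exact Real.log_le_log (mul_pos (hpos _) (hpos _)) hL
  obtain ⟨ψ, hψm, hψφ, hψsm⟩ := exists_measurable_supermodular_version_of_ae_plane φ hφm hsm
  refine ⟨fun x => ENNReal.ofReal (Real.exp (ψ x)), ENNReal.measurable_ofReal.comp (Real.measurable_exp.comp hψm),
    fun x => ⟨(ENNReal.ofReal_pos.2 (Real.exp_pos _)).ne', ENNReal.ofReal_ne_top⟩, ?_, fun x y => ?_⟩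
  · filter_upwards [hψφ] with x hx
    show ENNReal.ofReal (Real.exp (ψ x)) = f x
    rw [hx, hφ, Real.exp_log (hpos x), ENNReal.ofReal_toReal (hT x)]
  · show ENNReal.ofReal (Real.exp (ψ x)) * ENNReal.ofReal (Real.exp (ψ y)) ≤
      ENNReal.ofReal (Real.exp (ψ (x ⊓ y))) * ENNReal.ofReal (Real.exp (ψ (x ⊔ y)))
    rw [← ENNReal.ofReal_mul (Real.exp_pos _).le, ← ENNReal.ofReal_mul (Real.exp_pos _).le, ← Real.exp_add,
      ← Real.exp_add]
    exact ENNReal.ofReal_le_ofReal (Real.exp_le_exp.2 (hψsm x y))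

end Summit.CriticalPhenomena.PercolationContinuityZ3.Theorems.SahiAEFourFunctions.Plane
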